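import Literature.MathematicalPhysics.QuantumLattice.HeisenbergOrder
import Literature.MathematicalPhysics.QuantumLattice.HubbardModel
import Literature.MathematicalPhysics.QuantumLattice.HubbardNNNHopping
import Literature.MathematicalPhysics.QuantumLattice.PairCorrelations
import Literature.Barriers.HubbardSuperconductivity.PureModelStripeCompetition
import Literature.Probability.LatticeModels.CorrelationDecay
import Literature.Probability.LatticeModels.ThermodynamicLimit
import HarnessLib

/-!
# HubbardLadder — typed targets of the certified-numerics cell `pub-hubbard`

HONEST FRAMING: ladder R1–R4 with certified numbers; no claim on H/H₀.

This file only DEFINES the cell's targets as `Prop`s (nothing is asserted or proved about them):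

* (the `t–t'` Hubbard Hamiltonian `hubbardTorusTT' L t t' U` on the square torus — nearest-neighbour
  hopping `t`, diagonal next-nearest-neighbour hopping `t'`, on-site `U` — is imported from
  `Literature/MathematicalPhysics/QuantumLattice/HubbardNNNHopping.lean`; at `t' = 0` it is the tree's
  `hubbardTorus 2 L t U`, lemma `hubbardTorusTT'_zero`);
* H₀ := Néel long-range order in the ground state of the 2D spin-½ Heisenberg antiferromagnet on the
  square lattice, i.e. the `(d, n) = (2, 1)` case EXCLUDED from the named fact
  `kennedy_lieb_shastry_ground` (Kennedy–Lieb–Shastry 1988 prove `d = 3, S ≥ ½` and `d = 2, S ≥ 1`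
  only), together with its quantitative form "a uniform-in-size lower bound on the staggered
  magnetisation";
* H := the Hubbard dichotomy at `U/t = 8`, hole doping `1/8`: NO `d`-wave order for `t' = 0`
  (the tree's OPEN CONJECTURE `Literature.Barriers.HubbardSuperconductivity.PureModelStripeCompetition`
  is the weak form; the order-parameter form below is stronger) versus `d`-wave pair-field
  long-range order for `t'/t ≈ -0.25` (published locus `t'/t = -0.2`, Xu et al. 2024);
* (a ladder row R1 is a THEOREM `lo ≤ groundEnergy (hubbardTorusTT' L 1 t' U) N ∧ … ≤ hi` with rational
  endpoints, lower from a `certsdp/1` certificate via `le_groundEnergy_of_certificate`, upper from an exact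
  Rayleigh quotient via `groundEnergy_le_of_trial`; no predicate is introduced for it here).

Sources: TARGETS.md / LADDER.md of the cell (run/shared/lean/pub/pub-hubbard/); Qin et al. PRX 10
(2020) 031016; Xu et al. Science 384 (2024) eadh7691; Kennedy–Lieb–Shastry, J. Stat. Phys. 53 (1988)
1019; LeBlanc et al. PRX 5 (2015) 041041.
-/

noncomputable section

namespace Summit.HubbardSuperconductivity.HubbardLadder

open Matrix Finset Filter Literature.Probability.LatticeModels Literature.MathematicalPhysics.QuantumLattice
open Literature.Barriers.HubbardSuperconductivity
open scoped ComplexOrder Topology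

/-! ### H: the Hubbard dichotomy at `U/t = 8`, `δ = 1/8` (the `t–t'` model `hubbardTorusTT'` is the tree's
`Literature.MathematicalPhysics.QuantumLattice.hubbardTorusTT'`, file `HubbardNNNHopping.lean`) -/

/-- The finite-volume `d_{x²-y²}` pair-field order parameter (squared, per site²) of the state
`ψ (2k)` on the torus of side `2k`: `|Λ|⁻² Σ_{x,y} re⟨ψ, P_x† P_y ψ⟩ = |Λ|⁻² ⟨ψ, Δ_d† Δ_d ψ⟩`,
literally the sequence whose `liminf` the summit's `HasLongRangeOrder` conclusion takes
(Scalapino's pair-field correlation summed over the torus; the R2/R3 observable of the cell). -/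
def dWaveOrderParamSq (ψ : ∀ L, Fock (Orb (FermionTorus 2 L))) (k : ℕ) : ℝ :=
  (∑ x ∈ halfOpenBox 2 (2 * k), ∑ y ∈ halfOpenBox 2 (2 * k),
      torusPullback (pairFieldCorr dWaveFormFactor ψ) (2 * k) x y) /
    ((halfOpenBox 2 (2 * k)).card : ℝ) ^ 2

/-- OPEN CONJECTURE (cell target H, negative half; typed, NOT claimed) — **no `d_{x²-y²}` pair-field
order in the PURE (`t' = 0`) 2D Hubbard model at `U/t = 8`, hole doping `1/8`**, order-parameter form:
for EVERY admissible ground-state sequence (even tori, `N_L = 2⌊(7/8)L²/2⌋`, `S^z = 0` sector,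
normalised; the summit's hypotheses verbatim with `U = 8`, `δ = 1/8`) the finite-volume order
parameter `dWaveOrderParamSq ψ k` tends to `0`. STRONGER than the barrier catalogue's OPEN CONJECTURE
`PureModelStripeCompetition = ¬ HasDWavePairFieldLROAt 8 (1/8)` (that one only denies `liminf > 0`
for some sequence), WEAKER than "no Yang ODLRO anywhere in the `B₁g` sector". Posed — as the
conclusion of DMRG + CP-AFQMC computations, not of a proof — by Qin et al. (2020): "the pure Hubbard
model does not have a superconducting ground state … due to a competition with stripe order".
[cite: QinEtAl2020, §IV p. 11 and §III.B Fig. 9] [cite: ArovasBergKivelsonRaghu2022, §8.1 p. 31 and §9]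
[status: open] -/
@[conjecture] def NoDWaveOrderPureU8Eighth : Prop :=
  ∀ (N : ℕ → ℕ) (ψ : ∀ L, Fock (Orb (FermionTorus 2 L))),
    (∀ L, Even L → N L = 2 * ⌊(1 - 1 / 8) * (L : ℝ) ^ 2 / 2⌋₊ ∧ star (ψ L) ⬝ᵥ ψ L = 1 ∧
        IsGroundStateInSector (hubbardTorus 2 L 1 8) (N L) 0 (ψ L)) →
      Tendsto (dWaveOrderParamSq ψ) atTop (𝓝 0)

/-- OPEN CONJECTURE (cell target H, positive half at the HEADLINE locus; typed, NOT claimed) —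
**`d_{x²-y²}` pair-field long-range order in the `t–t'` Hubbard model at `t'/t = -1/4`, `U/t = 8`,
hole doping `1/8`**: every admissible ground-state sequence of `hubbardTorusTT' L 1 (-1/4) 8` (even
tori, `N_L = 2⌊(7/8)L²/2⌋`, `S^z = 0`, normalised) has Scalapino pair-field LRO — the summit's matrix
with the `t–t'` model in place of the pure one (so NOT an instance of the summit, whose model has
`t' = 0`). Posed, numerically, for `t'/t = -0.2` by Xu et al. (2024) ("superconductivity in both the
electron- and hole-doped regimes … with next nearest neighbor hopping"); `-1/4` is the cell's headline
value inside the DMRG convention band `-0.2 … -0.3`. [cite: XuEtAl2024, abstract and p. 2]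
[cite: ArovasBergKivelsonRaghu2022, §6 p. 25] [status: open] -/
@[conjecture] def DWaveOrderTPrimeQuarterU8Eighth : Prop :=
  ∀ (N : ℕ → ℕ) (ψ : ∀ L, Fock (Orb (FermionTorus 2 L))),
    (∀ L, Even L → N L = 2 * ⌊(1 - 1 / 8) * (L : ℝ) ^ 2 / 2⌋₊ ∧ star (ψ L) ⬝ᵥ ψ L = 1 ∧
        IsGroundStateInSector (hubbardTorusTT' L 1 (-1 / 4) 8) (N L) 0 (ψ L)) →
      HasLongRangeOrder (fun k => halfOpenBox 2 (2 * k))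
        (fun k => torusPullback (pairFieldCorr dWaveFormFactor ψ) (2 * k))

/-- OPEN CONJECTURE (cell target H, positive half at the PUBLISHED locus; typed, NOT claimed) — the
same statement at `t'/t = -1/5`, `U/t = 8`, `δ = 1/8`, the parameters of Xu et al. (2024).
[cite: XuEtAl2024, abstract and p. 2] [status: open] -/
@[conjecture] def DWaveOrderTPrimeFifthU8Eighth : Prop :=
  ∀ (N : ℕ → ℕ) (ψ : ∀ L, Fock (Orb (FermionTorus 2 L))),
    (∀ L, Even L → N L = 2 * ⌊(1 - 1 / 8) * (L : ℝ) ^ 2 / 2⌋₊ ∧ star (ψ L) ⬝ᵥ ψ L = 1 ∧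
        IsGroundStateInSector (hubbardTorusTT' L 1 (-1 / 5) 8) (N L) 0 (ψ L)) →
      HasLongRangeOrder (fun k => halfOpenBox 2 (2 * k))
        (fun k => torusPullback (pairFieldCorr dWaveFormFactor ψ) (2 * k))

/-- OPEN CONJECTURE (cell target H; typed, NOT claimed) — **the Hubbard dichotomy at `U/t = 8`, hole
doping `1/8`**: no `d`-wave pair-field order for `t' = 0` AND `d`-wave pair-field long-range order for
`t'/t = -1/4`. Both conjuncts are open as theorems; the evidence in print is numerical.
[cite: QinEtAl2020, §IV p. 11] [cite: XuEtAl2024, abstract] [status: open] -/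
@[conjecture] def HubbardDichotomyU8Eighth : Prop :=
  NoDWaveOrderPureU8Eighth ∧ DWaveOrderTPrimeQuarterU8Eighth

/-! ### H₀: Néel order of the spin-½ Heisenberg antiferromagnet on the square lattice -/

/-- The finite-volume Néel order parameter (staggered magnetisation squared per site²) of the
ground state of the spin-½ (`n = 1`) Heisenberg antiferromagnet `J Σ 𝐒_x·𝐒_y` on the torus
`(ℤ/Lℤ)²`: `m_s²(L) = L⁻⁴ Σ_{x,y} (-1)^x (-1)^y ⟨𝐒_x · 𝐒_y⟩_{GS,L}`, torus signs on canonical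
representatives (a consistent sublattice sign for even `L`; the summand of the tree's
`hasStaggeredEvenTorusLRO_iff`). Junk value `0` at `L = 0`. The R2 observable "staggered
magnetisation at half filling" on the Heisenberg side. -/
def neelOrderParamSq : (L : ℕ) → (J : ℝ) → ℝ
  | 0, _ => 0
  | L + 1, J =>
    (∑ x : TorusSite 2 (L + 1), ∑ y : TorusSite 2 (L + 1),
        (-1 : ℝ) ^ (∑ i, (x i).val) * (-1) ^ (∑ i, (y i).val) *
          groundStateSpinCorrTorus (d := 2) (L + 1) 1 J x y) /
      ((L + 1 : ℕ) : ℝ) ^ 4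

/-- OPEN CONJECTURE (cell target H₀; typed, NOT claimed) — **Néel long-range order in the ground state
of the 2D spin-½ Heisenberg antiferromagnet on the square lattice**, in the tree's vocabulary:
staggered long-range order along even tori of the ground-state spin–spin correlation at
`(d, n) = (2, 1)` for every `J > 0` — exactly the case excluded from the named fact
`kennedy_lieb_shastry_ground` (its side condition `d = 3 ∧ 1 ≤ n ∨ d = 2 ∧ 2 ≤ n` fails at
`(2, 1)`, by `omega`). Kennedy–Lieb–Shastry (1988): "In
two dimensions the above argument only shows that e₀ ≤ 1.064. The numerical estimates of e₀ are all
around 0.67, so we cannot conclude from inequality (4) that there is Néel order when S = 1/2."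
[cite: KennedyLiebShastryJSP1988, discussion after eq. (4)] [status: open] -/
@[conjecture] def NeelOrderSpinHalfSquare : Prop :=
  ∀ J : ℝ, 0 < J →
    HasStaggeredEvenTorusLRO (fun L x y => groundStateSpinCorrTorus (d := 2) L 1 J x y)

/-- OPEN CONJECTURE (cell target H₀, quantitative form; typed, NOT claimed) — **a uniform-in-size lower
bound on the staggered magnetisation**: some explicit `c > 0` with `m_s²(2k) ≥ c` for EVERY even side
`2k ≥ 2` and every `J > 0`. A certified R2 row at half filling brackets `neelOrderParamSq (2k) 1` at
ONE `k`; this asks for a `k`-uniform bound. [cite: KennedyLiebShastryJSP1988, discussion after eq. (4)]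
[status: open] -/
@[conjecture] def NeelOrderSpinHalfSquareUniform : Prop :=
  ∃ c : ℝ, 0 < c ∧ ∀ J : ℝ, 0 < J → ∀ k : ℕ, 1 ≤ k → c ≤ neelOrderParamSq (2 * k) J

end Summit.HubbardSuperconductivity.HubbardLadder

end
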